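import Summits.QuantumFields.YangMills.Theorems.IR.SCFloorCubeIntegral
import Literature.MathematicalPhysics.QuantumFieldTheory.LatticeGaugeProofs

/-!
# Strong-coupling floor engine, part 3: peeling on the doubled torus

Pooled prover `ym-ir-line-bsf-p1` (crux `IR`, stmt-QuantumFields-19354; director-ym R366 pooled queue), support file for
`FacingPlaquetteCovFloor`.  On the DOUBLED torus link configuration `W : Edge d L ⊕ Edge d L → G` (two independent
product-Haar copies `U = W ∘ inl`, `U' = W ∘ inr`, as in the doubling identity of `BetaSlopeFloorRungStrongCoupling`):

* §1 the four bonds `{(x,i),(x+eᵢ,j),(x+eⱼ,i),(x,j)}` of a torus plaquette; the holonomy does not read other bonds, and integrating ONE of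
  its bonds replaces the holonomy by a Haar variable (`integral_update_plaquetteHolonomy`, any integrand);
* §2 two-coordinate disintegration of the product integral (`integral_pi_eq_integral_integral_update₂`);
* §3 **antisymmetric-pair peeling** (`integral_antisymm_pair_eq_zero`): if a bond `ℓ` of the plaquette `p` is read, in
  both copies, only through the pair `(hol_p U, hol_p U')`, and the integrand is `A(hol_p U, hol_p U') · R(W)` with `A`
  ANTISYMMETRIC and `R` blind to `ℓ`, the integral vanishes — the exact mechanism that kills every replica / Mayer term
  whose polymer leaves a bond of one of the two observed plaquettes uncovered (part 4).

Group-blind plumbing; nothing here bears on the Yang–Mills mass gap.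
-/

set_option autoImplicit false

noncomputable section

open MeasureTheory Filter Topology Function
open Literature.MathematicalPhysics.QuantumFieldTheory
open Literature.MathematicalPhysics.QuantumLattice (integrable_prod_of_continuous)

namespace Summit.QuantumFields.YangMills.Cruxes.IR.SCFloor

variable {d L : ℕ} {G : Type*} [Group G]

/-! ## §1 Bonds of a torus plaquette -/

/-! The four bonds of the plaquette at `x` in the `(i,j)` plane (the bond variables read by `plaquetteHolonomy U x i j`)
are written throughout as the literal finset `{(x, i), (x.shift i, j), (x.shift j, i), (x, j)}` (no new definition). -/

/-- Membership in the bond finset of a plaquette, as a disjunction. -/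
theorem mem_pedges {x : Site d L} {i j : Fin d} {e : Edge d L} :
    e ∈ ({(x, i), (x.shift i, j), (x.shift j, i), (x, j)} : Finset (Edge d L)) ↔
      e = (x, i) ∨ e = (x.shift i, j) ∨ e = (x.shift j, i) ∨ e = (x, j) := by
  simp only [Finset.mem_insert, Finset.mem_singleton]

/-- The holonomy does not read bonds outside its four bonds. -/
theorem plaquetteHolonomy_update_of_not_mem {x : Site d L} {i j : Fin d} {e : Edge d L}
    (he : e ∉ ({(x, i), (x.shift i, j), (x.shift j, i), (x, j)} : Finset (Edge d L)))
    (U : GaugeConfig d L G) (g : G) :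
    plaquetteHolonomy (update U e g) x i j = plaquetteHolonomy U x i j := by
  rw [mem_pedges] at he
  push Not at he
  obtain ⟨h1, h2, h3, h4⟩ := he
  simp only [plaquetteHolonomy, update_of_ne (Ne.symm h1), update_of_ne (Ne.symm h2),
    update_of_ne (Ne.symm h3), update_of_ne (Ne.symm h4)]

/-- On a torus of side `L ≥ 2`, `x + e_k ≠ x`. -/
theorem shift_ne_self [Fact (1 < L)] (x : Site d L) (k : Fin d) : x.shift k ≠ x := by
  intro h
  have h1 := congrFun h k
  simp only [Site.shift, Pi.add_apply, Pi.single_eq_same, add_eq_left] at h1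
  exact one_ne_zero h1

/-- The holonomy after updating one of the four bonds (`i ≠ j`, `L ≥ 2`: the four bonds are distinct). -/
theorem plaquetteHolonomy_update [Fact (1 < L)] (x : Site d L) {i j : Fin d} (hij : i ≠ j)
    (U : GaugeConfig d L G) (g : G) :
    plaquetteHolonomy (update U (x, i) g) x i j =
        g * U (x.shift i, j) * (U (x.shift j, i))⁻¹ * (U (x, j))⁻¹ ∧
    plaquetteHolonomy (update U (x.shift i, j) g) x i j =
        U (x, i) * g * (U (x.shift j, i))⁻¹ * (U (x, j))⁻¹ ∧
    plaquetteHolonomy (update U (x.shift j, i) g) x i j =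
        U (x, i) * U (x.shift i, j) * g⁻¹ * (U (x, j))⁻¹ ∧
    plaquetteHolonomy (update U (x, j) g) x i j =
        U (x, i) * U (x.shift i, j) * (U (x.shift j, i))⁻¹ * g⁻¹ := by
  have hx : ∀ k : Fin d, x.shift k ≠ x := shift_ne_self x
  have h12 : ((x, i) : Edge d L) ≠ (x.shift i, j) := fun h => hx i (Prod.ext_iff.1 h).1.symm
  have h13 : ((x, i) : Edge d L) ≠ (x.shift j, i) := fun h => hx j (Prod.ext_iff.1 h).1.symm
  have h14 : ((x, i) : Edge d L) ≠ (x, j) := fun h => hij (Prod.ext_iff.1 h).2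
  have h23 : ((x.shift i, j) : Edge d L) ≠ (x.shift j, i) := fun h => hij ((Prod.ext_iff.1 h).2).symm
  have h24 : ((x.shift i, j) : Edge d L) ≠ (x, j) := fun h => hx i (Prod.ext_iff.1 h).1
  have h34 : ((x.shift j, i) : Edge d L) ≠ (x, j) := fun h => hx j (Prod.ext_iff.1 h).1
  simp only [plaquetteHolonomy, update_self, update_of_ne h12.symm, update_of_ne h13.symm,
    update_of_ne h14.symm, update_of_ne h12, update_of_ne h23.symm, update_of_ne h24.symm,
    update_of_ne h13, update_of_ne h23, update_of_ne h34.symm, update_of_ne h14, update_of_ne h24,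
    update_of_ne h34, and_self]

variable [TopologicalSpace G] [IsTopologicalGroup G] [CompactSpace G] [MeasurableSpace G] [BorelSpace G]

/-- **Haar invariance over one bond (torus)**: integrating ANY function of the plaquette holonomy over one of its
four bond variables gives its Haar average. -/
theorem integral_update_plaquetteHolonomy [Fact (1 < L)] {E : Type*} [NormedAddCommGroup E]
    [NormedSpace ℝ E] (Ψ : G → E) (x : Site d L) {i j : Fin d} (hij : i ≠ j) (U : GaugeConfig d L G)
    {e : Edge d L} (he : e ∈ ({(x, i), (x.shift i, j), (x.shift j, i), (x, j)} : Finset (Edge d L))) :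
    ∫ g, Ψ (plaquetteHolonomy (update U e g) x i j) ∂haarProbability G = ∫ g, Ψ g ∂haarProbability G := by
  rw [mem_pedges] at he
  have h1 := fun g => (plaquetteHolonomy_update x hij U g).1
  have h2 := fun g => (plaquetteHolonomy_update x hij U g).2.1
  have h3 := fun g => (plaquetteHolonomy_update x hij U g).2.2.1
  have h4 := fun g => (plaquetteHolonomy_update x hij U g).2.2.2
  rcases he with rfl | rfl | rfl | rfl
  · simp_rw [h1]
    have := integral_haar_conj_eq Ψ 1 (U (x.shift i, j) * (U (x.shift j, i))⁻¹ * (U (x, j))⁻¹)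
    simpa [mul_assoc] using this
  · simp_rw [h2]
    have := integral_haar_conj_eq Ψ (U (x, i)) ((U (x.shift j, i))⁻¹ * (U (x, j))⁻¹)
    simpa [mul_assoc] using this
  · simp_rw [h3]
    exact integral_haar_conj_inv_eq Ψ _ _
  · simp_rw [h4]
    have := integral_haar_conj_inv_eq Ψ (U (x, i) * U (x.shift i, j) * (U (x.shift j, i))⁻¹) 1
    simpa using this

/-! ## §2 Doubled configurations -/

section Doubled

variable {ι : Type*} [DecidableEq ι]

omit [TopologicalSpace G] [IsTopologicalGroup G] [CompactSpace G] [MeasurableSpace G] [BorelSpace G] [Group G] in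
/-- Updating the left copy of `ℓ`, seen from the left copy. -/
theorem comp_inl_update_inl (W : ι ⊕ ι → G) (ℓ : ι) (g : G) :
    (fun e => update W (Sum.inl ℓ) g (Sum.inl e)) = update (fun e => W (Sum.inl e)) ℓ g := by
  funext e
  by_cases h : e = ℓ
  · subst h; simp
  · rw [update_of_ne (by simpa using h), update_of_ne h]

omit [TopologicalSpace G] [IsTopologicalGroup G] [CompactSpace G] [MeasurableSpace G] [BorelSpace G] [Group G] in
/-- Updating the right copy of `ℓ`, seen from the right copy. -/
theorem comp_inr_update_inr (W : ι ⊕ ι → G) (ℓ : ι) (g : G) :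
    (fun e => update W (Sum.inr ℓ) g (Sum.inr e)) = update (fun e => W (Sum.inr e)) ℓ g := by
  funext e
  by_cases h : e = ℓ
  · subst h; simp
  · rw [update_of_ne (by simpa using h), update_of_ne h]

omit [TopologicalSpace G] [IsTopologicalGroup G] [CompactSpace G] [MeasurableSpace G] [BorelSpace G] [Group G] in
/-- Updating the left copy of `ℓ` does not change the right copy. -/
theorem comp_inr_update_inl (W : ι ⊕ ι → G) (ℓ : ι) (g : G) :
    (fun e => update W (Sum.inl ℓ) g (Sum.inr e)) = fun e => W (Sum.inr e) := by
  funext e; rw [update_of_ne Sum.inr_ne_inl]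

omit [TopologicalSpace G] [IsTopologicalGroup G] [CompactSpace G] [MeasurableSpace G] [BorelSpace G] [Group G] in
/-- Updating the right copy of `ℓ` does not change the left copy. -/
theorem comp_inl_update_inr (W : ι ⊕ ι → G) (ℓ : ι) (g : G) :
    (fun e => update W (Sum.inr ℓ) g (Sum.inl e)) = fun e => W (Sum.inl e) := by
  funext e; rw [update_of_ne Sum.inl_ne_inr]

end Doubled

/-! ## §3 Two-coordinate disintegration and antisymmetric-pair peeling -/

section Peel

variable [SecondCountableTopology G] {ι : Type*} [Fintype ι] [DecidableEq ι]

omit [SecondCountableTopology G] [Fintype ι] in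
/-- Parametric one-coordinate Haar integrals of a bounded measurable function are measurable and bounded. -/
theorem measurable_integral_update (a : ι) {Φ : (ι → G) → ℝ} (hΦm : Measurable Φ) :
    Measurable fun U : ι → G => ∫ g, Φ (update U a g) ∂haarProbability G := by
  have h : Measurable (uncurry fun (U : ι → G) (g : G) => Φ (update U a g)) :=
    hΦm.comp (measurable_update'.comp (measurable_fst.prodMk measurable_snd))
  exact (h.stronglyMeasurable.integral_prod_right').measurable

omit [SecondCountableTopology G] [Fintype ι] in
/-- The one-coordinate Haar average of a function bounded by `C` is bounded by `C`. -/
theorem abs_integral_update_le (a : ι) {Φ : (ι → G) → ℝ} {C : ℝ} (hΦb : ∀ U, |Φ U| ≤ C)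
    (U : ι → G) : |∫ g, Φ (update U a g) ∂haarProbability G| ≤ C := by
  have hC : 0 ≤ C := (abs_nonneg _).trans (hΦb U)
  refine (abs_integral_le_integral_abs).trans ?_
  calc ∫ g, |Φ (update U a g)| ∂haarProbability G ≤ ∫ _g, C ∂haarProbability G :=
        integral_mono_of_nonneg (Eventually.of_forall fun _ => abs_nonneg _) (integrable_const C)
          (Eventually.of_forall fun g => hΦb _)
    _ = C := by simp

/-- **Disintegration along two coordinates**: `∫ Φ dπ = ∫ (∫∫ Φ(update (update U a g) b g') dg' dg) dπ(U)`. -/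
theorem integral_pi_eq_integral_integral_update₂ (a b : ι) {Φ : (ι → G) → ℝ} (hΦm : Measurable Φ)
    {C : ℝ} (hΦb : ∀ U, |Φ U| ≤ C) :
    ∫ U, Φ U ∂(Measure.pi fun _ : ι => haarProbability G) =
      ∫ U, (∫ g, ∫ g', Φ (update (update U a g) b g') ∂haarProbability G ∂haarProbability G)
        ∂(Measure.pi fun _ : ι => haarProbability G) := by
  rw [integral_pi_eq_integral_integral_update b hΦm hΦb]
  rw [integral_pi_eq_integral_integral_update a (measurable_integral_update b hΦm)
    (abs_integral_update_le b hΦb)]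

variable [Fact (1 < L)] [T2Space G]

/-- **Antisymmetric-pair peeling.**  On the doubled torus configuration `W : Edge d L ⊕ Edge d L → G`, let `ℓ` be a
bond of the plaquette `(x,i,j)` and let the integrand be `A(hol U, hol U') · R W` with `A` continuous and
ANTISYMMETRIC (`A a b = −A b a`) and `R` bounded measurable and blind to the two copies of `ℓ`.  Then the integral
vanishes: integrating the two copies of `ℓ` turns `(hol U, hol U')` into an independent Haar pair `(g, g')`, and
`∫∫ A(g,g') = −∫∫ A(g,g')` by Fubini. -/
theorem integral_antisymm_pair_eq_zero (x : Site d L) {i j : Fin d} (hij : i ≠ j) {ℓ : Edge d L}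
    (hℓ : ℓ ∈ ({(x, i), (x.shift i, j), (x.shift j, i), (x, j)} : Finset (Edge d L))) {A : G → G → ℝ}
    (hAc : Continuous (uncurry A))
    (hAa : ∀ a b, A a b = -A b a) {R : (Edge d L ⊕ Edge d L → G) → ℝ} (hRm : Measurable R) {CR : ℝ}
    (hRb : ∀ W, |R W| ≤ CR) (hRl : ∀ W g, R (update W (Sum.inl ℓ) g) = R W)
    (hRr : ∀ W g, R (update W (Sum.inr ℓ) g) = R W) :
    ∫ W, A (plaquetteHolonomy (fun e => W (Sum.inl e)) x i j)
        (plaquetteHolonomy (fun e => W (Sum.inr e)) x i j) * R W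
      ∂(Measure.pi fun _ : Edge d L ⊕ Edge d L => haarProbability G) = 0 := by
  -- measurability and boundedness of the integrand
  obtain ⟨CA, hCA⟩ := isCompact_univ.exists_bound_of_continuousOn hAc.continuousOn
  have hAm : Measurable (uncurry A) := hAc.measurable
  have hl : Measurable fun W : Edge d L ⊕ Edge d L → G => fun e => W (Sum.inl e) :=
    measurable_pi_lambda _ fun e => measurable_pi_apply (Sum.inl e)
  have hr : Measurable fun W : Edge d L ⊕ Edge d L → G => fun e => W (Sum.inr e) :=
    measurable_pi_lambda _ fun e => measurable_pi_apply (Sum.inr e)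
  have hholl : Measurable fun W : Edge d L ⊕ Edge d L → G =>
      plaquetteHolonomy (fun e => W (Sum.inl e)) x i j :=
    (measurable_plaquetteHolonomy x i j).comp hl
  have hholr : Measurable fun W : Edge d L ⊕ Edge d L → G =>
      plaquetteHolonomy (fun e => W (Sum.inr e)) x i j :=
    (measurable_plaquetteHolonomy x i j).comp hr
  have hΦm : Measurable fun W : Edge d L ⊕ Edge d L → G =>
      A (plaquetteHolonomy (fun e => W (Sum.inl e)) x i j)
        (plaquetteHolonomy (fun e => W (Sum.inr e)) x i j) * R W :=
    (hAm.comp (hholl.prodMk hholr)).mul hRm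
  have hCA0 : 0 ≤ CA := (norm_nonneg _).trans (hCA (1, 1) (Set.mem_univ _))
  have hΦb : ∀ W : Edge d L ⊕ Edge d L → G,
      |A (plaquetteHolonomy (fun e => W (Sum.inl e)) x i j)
        (plaquetteHolonomy (fun e => W (Sum.inr e)) x i j) * R W| ≤ CA * CR := fun W => by
    rw [abs_mul]
    have h1 := hCA (plaquetteHolonomy (fun e => W (Sum.inl e)) x i j,
      plaquetteHolonomy (fun e => W (Sum.inr e)) x i j) (Set.mem_univ _)
    rw [Real.norm_eq_abs] at h1
    exact mul_le_mul h1 (hRb W) (abs_nonneg _) hCA0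
  rw [integral_pi_eq_integral_integral_update₂ (Sum.inl ℓ) (Sum.inr ℓ) hΦm hΦb]
  -- the inner double integral is the constant `∫∫ A`, which vanishes by antisymmetry
  have hinner : ∀ W : Edge d L ⊕ Edge d L → G,
      (∫ g, ∫ g', (fun W : Edge d L ⊕ Edge d L → G =>
          A (plaquetteHolonomy (fun e => W (Sum.inl e)) x i j)
            (plaquetteHolonomy (fun e => W (Sum.inr e)) x i j) * R W)
          (update (update W (Sum.inl ℓ) g) (Sum.inr ℓ) g') ∂haarProbability G ∂haarProbability G) =
      (∫ g, ∫ g', A g g' ∂haarProbability G ∂haarProbability G) * R W := by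
    intro W
    have hrew : ∀ g g', (fun W : Edge d L ⊕ Edge d L → G =>
          A (plaquetteHolonomy (fun e => W (Sum.inl e)) x i j)
            (plaquetteHolonomy (fun e => W (Sum.inr e)) x i j) * R W)
          (update (update W (Sum.inl ℓ) g) (Sum.inr ℓ) g') =
        A (plaquetteHolonomy (update (fun e => W (Sum.inl e)) ℓ g) x i j)
          (plaquetteHolonomy (update (fun e => W (Sum.inr e)) ℓ g') x i j) * R W := by
      intro g g'
      dsimp only
      rw [comp_inl_update_inr, comp_inr_update_inr, comp_inr_update_inl, comp_inl_update_inl, hRr, hRl]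
    simp_rw [hrew]
    simp_rw [integral_mul_const]
    congr 1
    have h1 : ∀ g, ∫ g', A (plaquetteHolonomy (update (fun e => W (Sum.inl e)) ℓ g) x i j)
        (plaquetteHolonomy (update (fun e => W (Sum.inr e)) ℓ g') x i j) ∂haarProbability G =
        ∫ g', A (plaquetteHolonomy (update (fun e => W (Sum.inl e)) ℓ g) x i j) g' ∂haarProbability G :=
      fun g => integral_update_plaquetteHolonomy (A _) x hij _ hℓ
    simp_rw [h1]
    exact integral_update_plaquetteHolonomy (fun h => ∫ g', A h g' ∂haarProbability G) x hij _ hℓ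
  simp_rw [hinner]
  -- `∫∫ A = 0`
  have hI : Integrable (uncurry A) ((haarProbability G).prod (haarProbability G)) :=
    integrable_prod_of_continuous hAc _ _
  have hswap := integral_integral_swap hI
  have hzero : ∫ g, ∫ g', A g g' ∂haarProbability G ∂haarProbability G = 0 := by
    have h1 : ∫ g, ∫ g', A g g' ∂haarProbability G ∂haarProbability G =
        -∫ g, ∫ g', A g' g ∂haarProbability G ∂haarProbability G := by
      rw [← integral_neg]
      refine integral_congr_ae (Eventually.of_forall fun g => ?_)
      dsimp only
      rw [← integral_neg]
      refine integral_congr_ae (Eventually.of_forall fun g' => ?_)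
      exact hAa g g'
    have h2 : ∫ g, ∫ g', A g' g ∂haarProbability G ∂haarProbability G =
        ∫ g, ∫ g', A g g' ∂haarProbability G ∂haarProbability G := by
      simpa only [uncurry_apply_pair] using hswap.symm
    rw [h2] at h1
    linarith
  simp [hzero]

end Peel

end Summit.QuantumFields.YangMills.Cruxes.IR.SCFloor

end
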